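import Summits.Ventures.CertifiedArithmetic.LowPrec.DoubleRoundingFMABinadeFrame

/-!
# Double rounding of the FMA — the first binade above `W` decided exactly (THEOREM D-fma-M♯)

HONEST FRAMING: certified error envelopes and provably optimal rounding/accumulation schemes for
low-precision formats under stated cost models; every table by two implementations; no hardware
or vendor claims.

THEOREM D-fma-M♯ (every pair of format records).  Under the grid conditions of THEOREM D-fma-M —
`F_φ ⊆ F_ψ` (`embedsTest`), `2 P_φ ≤ P_ψ`, `bias φ ≤ bias ψ`, `L_ψ ≤ 2 L_φ`, `L_ψ + P_ψ ≤ L_φ`,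
`m ≥ 1`, `bias φ ≥ 1` — with `m_ψ = m + n`, `n ≥ m + 2`, `k + m + bias φ = n + 1` and a source whose
largest finite value lies in the first binade above `W = 2^(m+1+k)·quantum φ`,
`M_φ = (2^m + J)·2^(k+1)` quanta with `J ≤ 2^m`:

  `DFma φ ψ ↔ fmaBinadeSlipTest m n J = false`                                (`dFma_binade_iff`)

— one fused multiply-add of `φ`-data in `ψ`, converted to `φ`, is correctly rounded for ALL data
iff no midpoint `μ_t = W + (2j+1)·h` below `M_φ` (`t = 2^m + j`, `j < J`, `h = 2^k·quantum φ`)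
carries a slip datum `a = a₁`, `b = ±b₁`, `c = w·2^k` quanta, `a·b + c = μ_t ± quantum φ²`.
Soundness is the slip frame `binade_slip_sig` (`DoubleRoundingFMABinadeFrame.lean`); completeness
(`not_dFma_of_fmaBinadeSlipTest`) builds the datum of a passing candidate and applies the tie
lemmas `roundNE_roundNE_ne_gmid_tie` (`t` even, from above) / `roundNE_roundNE_ne_gmid_tie_below`
(`t` odd, from below).  THE TEST IS MONOTONE IN `J` and independent of `bias φ`: the binade is
decided by ONE NUMBER `J⋆(m, n)`, the least `J` passing; `J⋆ = 1` exactly when `fmaMidPairTest m n`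
(THEOREM D-fma-M's side condition is the case `J = 1`: `fmaBinadeSlip_one_table`, `m ≤ 8`), so on
every middle column with `P_φ ≤ 12` the threshold is `W` itself; at the first exception
`(m, n) = (12, 23)` (`P = 13` through `P_ψ = 36`) the kernel evaluates `J⋆ = 2`
(`fmaBinadeSlip_12_23_one`, `fmaBinadeSlip_12_23_two`): `DFma` holds up to `M_φ = W + 2h` and
fails from `W + 4h` on (datum `6563·7669 = 6·2^23 - 1`, `c = W - 3h`, one `quantum φ²` below
`μ = W + 3h`).  At `(16, 31)` implementation A finds NO slip in the whole binade (`J⋆ > 2^16`: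
`DFma` for every `M_φ ≤ 2W`; of the `34` numbers `|e·2^31 ± 1|`, `|e| ≤ 8`, only `2^32 - 1 =
65535·65537` factors into two `17`-bit significands, and its parity is wrong) — a table entry by two
implementations, beyond the kernel's budget.  NAMED CELLS: none of the `169` has its largest value
in the first binade of a `n ≥ m + 2` register (they sit below `W` or beyond `2W`); the phenomenon
lives on unnamed source ranges, as THEOREM D-fma-M's odd columns do.  PLACEMENT: innocuous
double rounding [Figueroa1995] §3, [Roux2014] §2; FMA by rounding to odd [BoldoMelquiond2008]
Thm 3; the midpoint property [MartinDorelMelquiondMuller2013] Property 2.1; no record-level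
decision of the FMA through a `2P … 3P-2`-digit register over a range of source maxima was found in
the literature searched (queries in the cell's notes).  Implementation A:
`code/enum/fma_binade_law.py` → `DOUBLE-ROUNDING-FMA.md` §14,
`certs/enum/DOUBLE-ROUNDING-FMA-BINADE.json`.  No hardware or vendor claims.
-/

namespace Summit.Ventures.CertifiedArithmetic

open Literature.ComputerArithmetic.FloatingPoint
open Literature.ComputerArithmetic.FloatingPoint.Format
open Literature.ComputerArithmetic.FloatingPoint.MiniFloat

/-! ## §1 Completeness: every passing candidate is a slip datum -/

/-- THE DATUM OF A CANDIDATE.  `bias φ ≥ 1`, `k + m + bias φ = n + 1`, `M_φ = (2^m + J)·2^(k+1)`,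
`j < J ≤ 2^m`, `w = 2(2^m + j) + 1 - e` in range (`2^m ≤ w ≤ 2^(m+1) + 2J`, even once
`w ≥ 2^(m+1)`), `|e·2^n + σ| = a₁·b₁` with `a₁, b₁ < 2^(m+1)`: data `a, b, c`
of `φ` with `a·b + c = (2(2^m + j) + 1)·2^k·quantum φ + σ·quantum φ²` (`a = a₁`, `b = ±b₁`,
`c = w·2^k` quanta). [this packet] -/
theorem exists_binade_data {φ : Format} (hb : 1 ≤ φ.bias) {n k J j a₁ b₁ : ℕ} {e σ : ℤ}
    (hk : k + (φ.manBits + φ.bias) = n + 1) (hJ : J ≤ 2 ^ φ.manBits)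
    (hM : φ.maxScaled = (2 ^ φ.manBits + J) * 2 ^ (k + 1)) (hj : j < J)
    (hw1 : (2 : ℤ) ^ φ.manBits ≤ 2 * (2 ^ φ.manBits + j) + 1 - e)
    (hw2 : 2 * ((2 : ℤ) ^ φ.manBits + j) + 1 - e ≤ 2 ^ (φ.manBits + 1) + 2 * J)
    (hw3 : 2 * ((2 : ℤ) ^ φ.manBits + j) + 1 - e < 2 ^ (φ.manBits + 1)
      ∨ (2 * ((2 : ℤ) ^ φ.manBits + j) + 1 - e) % 2 = 0)
    (ha₁ : a₁ < 2 ^ (φ.manBits + 1)) (hb₁ : b₁ < 2 ^ (φ.manBits + 1))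
    (hab : (e * 2 ^ n + σ).natAbs = a₁ * b₁) :
    ∃ a b c : MiniFloat φ, a.toRat * b.toRat + c.toRat =
      (((2 * (2 ^ φ.manBits + j) + 1) * 2 ^ k : ℕ) : ℚ) * φ.quantum
        + (σ : ℚ) * (φ.quantum * φ.quantum) := by
  have hkey : (2 : ℚ) ^ n * φ.quantum = 2 ^ k := by
    rw [show n = k + (φ.manBits + (φ.bias - 1)) by omega, pow_add, mul_assoc,
      two_pow_mul_quantum_eq_one hb, mul_one]
  have hWM : 2 ^ φ.manBits * 2 ^ (k + 1) ≤ φ.maxScaled := by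
    rw [hM]; exact Nat.mul_le_mul_right _ (Nat.le_add_right _ _)
  have hsmall : 2 ^ (φ.manBits + 1) ≤ φ.maxScaled :=
    le_trans (by rw [pow_succ]; exact Nat.mul_le_mul_left _ (by
      calc 2 = 2 ^ 1 := (pow_one 2).symm
        _ ≤ 2 ^ (k + 1) := Nat.pow_le_pow_right (by norm_num) (by omega))) hWM
  -- `a = a₁`, `b = s·b₁` with `s·(a₁·b₁) = e·2^n + σ`
  obtain ⟨a, ha⟩ := exists_toRat_eq_natMul (representable_of_lt_pow ha₁ (by omega))
  obtain ⟨s, hs, hZ⟩ : ∃ s : ℤ, (s = 1 ∨ s = -1) ∧ e * 2 ^ n + σ = s * ((a₁ * b₁ : ℕ) : ℤ) := by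
    rcases Int.natAbs_eq (e * 2 ^ n + σ) with h0 | h0
    · exact ⟨1, Or.inl rfl, by rw [one_mul, ← hab]; exact h0⟩
    · exact ⟨-1, Or.inr rfl, by rw [neg_one_mul, ← hab]; exact h0⟩
  have hsb : (s * b₁).natAbs = b₁ := by
    rcases hs with rfl | rfl <;> simp
  obtain ⟨b, hb2⟩ := exists_toRat_eq_intCast_mul (φ := φ) (T := s * b₁)
    (by rw [hsb]; exact representable_of_lt_pow hb₁ (by omega))
  -- `c = w·2^k`
  have h2m : (0 : ℤ) < 2 ^ φ.manBits := by positivity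
  obtain ⟨w, hw⟩ : ∃ w : ℕ, (w : ℤ) = 2 * (2 ^ φ.manBits + j) + 1 - e :=
    ⟨(2 * ((2 : ℤ) ^ φ.manBits + j) + 1 - e).toNat, Int.toNat_of_nonneg (by linarith)⟩
  have hcrep : φ.Representable (w * 2 ^ k) := by
    rcases hw3 with h0 | h0
    · have hwlt : w < 2 ^ (φ.manBits + 1) := by
        have : (w : ℤ) < 2 ^ (φ.manBits + 1) := by rw [hw]; exact h0
        exact_mod_cast this
      refine representable_mul_pow hwlt (le_trans ?_ hWM)
      rw [pow_succ 2 k, show 2 ^ φ.manBits * (2 ^ k * 2) = 2 ^ (φ.manBits + 1) * 2 ^ k by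
        rw [pow_succ]; ring]
      exact Nat.mul_le_mul_right _ hwlt.le
    · obtain ⟨w', hw'⟩ : ∃ w', w = 2 * w' := ⟨w / 2, by
        have : (w : ℤ) % 2 = 0 := by rw [hw]; exact h0
        omega⟩
      have hw'le : w' ≤ 2 ^ φ.manBits + J := by
        have : (w : ℤ) ≤ 2 ^ (φ.manBits + 1) + 2 * J := by rw [hw]; exact hw2
        push_cast [hw', pow_succ] at this
        have h3 : ((2 * w' : ℕ) : ℤ) ≤ ((2 * (2 ^ φ.manBits + J) : ℕ) : ℤ) := by
          push_cast; linarith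
        have h4 : 2 * w' ≤ 2 * (2 ^ φ.manBits + J) := by exact_mod_cast h3
        omega
      have e1 : w * 2 ^ k = w' * 2 ^ (k + 1) := by rw [hw', pow_succ]; ring
      rw [e1]
      refine representable_mul_pow_of_le (by rw [pow_succ]; omega) ?_
      rw [hM]; exact Nat.mul_le_mul_right _ hw'le
  obtain ⟨c, hc⟩ := exists_toRat_eq_natMul hcrep
  -- the sum
  have hZq : (e : ℚ) * 2 ^ n + σ = s * (a₁ * b₁) := by exact_mod_cast hZ
  have hwq : (w : ℚ) = 2 * (2 ^ φ.manBits + j) + 1 - e := by exact_mod_cast hw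
  refine ⟨a, b, c, ?_⟩
  rw [ha, hb2, hc]
  push_cast
  linear_combination (-(φ.quantum * φ.quantum)) * hZq + (2 ^ k * φ.quantum) * hwq
    + ((e : ℚ) * φ.quantum) * hkey

/-- THEOREM D-fma-M♯, the refutation (completeness of the test): grids nested (`embedsTest`),
`2 P_φ ≤ P_ψ`, `L_ψ ≤ 2 L_φ`, `m ≥ 1`, `bias φ ≥ 1`, `m_ψ = m + n`, `k + m + bias φ = n + 1`,
`M_φ = (2^m + J)·2^(k+1)` with `J ≤ 2^m`, and `fmaBinadeSlipTest m n J` ⟹ `¬ DFma φ ψ`: the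
datum of the passing candidate sums to `μ_t + quantum φ²` (`t` even) or `μ_t - quantum φ²`
(`t` odd), a tie of `ψ` resolved ONTO the midpoint `μ_t` of `φ`, which then resolves away from
`fl_φ` of the sum (`roundNE_roundNE_ne_gmid_tie[_below]`). [cite: BoldoMelquiond2008, Thm 3] -/
theorem not_dFma_of_fmaBinadeSlipTest {φ ψ : Format} (hE : embedsTest φ ψ = true)
    (hm : 2 * φ.manBits + 1 ≤ ψ.manBits) (hq2 : ψ.qexp ≤ 2 * φ.qexp) (h1 : 1 ≤ φ.manBits)
    (hb : 1 ≤ φ.bias) {n k J : ℕ} (hn : ψ.manBits = φ.manBits + n)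
    (hk : k + (φ.manBits + φ.bias) = n + 1) (hJ : J ≤ 2 ^ φ.manBits)
    (hM : φ.maxScaled = (2 ^ φ.manBits + J) * 2 ^ (k + 1))
    (hT : fmaBinadeSlipTest φ.manBits n J = true) : ¬ DFma φ ψ := by
  have hE' := hE
  simp only [embedsTest, Bool.and_eq_true, decide_eq_true_eq] at hE'
  obtain ⟨⟨-, hq⟩, hMψ⟩ := hE'
  -- the grid of `ψ` is fine enough at the midpoints: `m_ψ ≤ m + k + D`
  set d := (φ.qexp - ψ.qexp).toNat with hd
  have hd0 : ((d : ℕ) : ℤ) = φ.qexp - ψ.qexp := Int.toNat_of_nonneg (by omega)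
  have hk' : ψ.manBits ≤ φ.manBits + k + d := by
    have : (φ.manBits : ℤ) + φ.bias - 1 ≤ d := by unfold Format.qexp at hd0 hq2; omega
    omega
  have hqψ := ψ.quantum_pos
  have hquant : φ.quantum = 2 ^ d * ψ.quantum := quantum_eq_two_pow_mul hq
  have hkey : (2 : ℚ) ^ n * φ.quantum = 2 ^ k := by
    rw [show n = k + (φ.manBits + (φ.bias - 1)) by omega, pow_add, mul_assoc,
      two_pow_mul_quantum_eq_one hb, mul_one]
  have hδψ : 2 * (φ.quantum * φ.quantum)
      = 2 ^ (φ.manBits + k + d + 1 - ψ.manBits) * ψ.quantum := by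
    have H : (2 : ℚ) ^ n * (2 * (φ.quantum * φ.quantum))
        = 2 ^ n * (2 ^ (φ.manBits + k + d + 1 - ψ.manBits) * ψ.quantum) := by
      calc (2 : ℚ) ^ n * (2 * (φ.quantum * φ.quantum))
          = 2 * (2 ^ n * φ.quantum) * φ.quantum := by ring
        _ = 2 ^ (k + d + 1) * ψ.quantum := by rw [hkey, hquant, pow_add, pow_succ]; ring
        _ = 2 ^ (n + (φ.manBits + k + d + 1 - ψ.manBits)) * ψ.quantum := by
            rw [show n + (φ.manBits + k + d + 1 - ψ.manBits) = k + d + 1 by omega]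
        _ = 2 ^ n * (2 ^ (φ.manBits + k + d + 1 - ψ.manBits) * ψ.quantum) := by
            rw [pow_add]; ring
    exact mul_left_cancel₀ (by positivity) H
  -- read the candidate
  unfold fmaBinadeSlipTest at hT
  obtain ⟨j, hjm, hT⟩ := List.any_eq_true.mp hT
  rw [List.mem_range] at hjm
  obtain ⟨i, -, hc⟩ := List.any_eq_true.mp hT
  simp only [fmaBinadeCond, Bool.and_eq_true, Bool.or_eq_true, decide_eq_true_eq] at hc
  obtain ⟨⟨⟨hw1, hw2⟩, hw3⟩, hsig⟩ := hc
  obtain ⟨a₁, b₁, -, ha₁, hb₁, hab⟩ := exists_mul_of_twoSigTest hsig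
  obtain ⟨a, b, c, habc⟩ := exists_binade_data hb hk hJ hM hjm hw1 hw2 hw3 ha₁ hb₁ hab
  -- the midpoint `t = 2^m + j`
  have h2e : Even (2 ^ φ.manBits) := Nat.even_pow.mpr ⟨even_two, by omega⟩
  have htlo : 2 ^ φ.manBits ≤ 2 ^ φ.manBits + j := Nat.le_add_right _ _
  have hthi : 2 ^ φ.manBits + j < 2 ^ (φ.manBits + 1) := by rw [pow_succ]; omega
  have hu : (2 ^ φ.manBits + j + 1) * 2 ^ (k + 1) ≤ φ.maxScaled := by
    rw [hM]; exact Nat.mul_le_mul_right _ (by omega)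
  intro hD
  have h' := hD a b c
  rw [habc] at h'
  by_cases hpar : j % 2 = 0
  · rw [if_pos hpar] at h'
    simp only [Int.cast_one, one_mul] at h'
    have hte : Even (2 ^ φ.manBits + j) := h2e.add (Nat.even_iff.mpr hpar)
    exact roundNE_roundNE_ne_gmid_tie hq hMψ h1 (by omega) hte htlo hthi hu hk' hδψ h'
  · rw [if_neg hpar] at h'
    have e1 : (((2 * (2 ^ φ.manBits + j) + 1) * 2 ^ k : ℕ) : ℚ) * φ.quantum
        + (((-1 : ℤ) : ℚ)) * (φ.quantum * φ.quantum)
        = (((2 * (2 ^ φ.manBits + j) + 1) * 2 ^ k : ℕ) : ℚ) * φ.quantum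
          - φ.quantum * φ.quantum := by push_cast; ring
    rw [e1] at h'
    have hto : Odd (2 ^ φ.manBits + j) := h2e.add_odd (Nat.odd_iff.mpr (by omega))
    exact roundNE_roundNE_ne_gmid_tie_below hq hMψ h1 (by omega) hto htlo hthi hu hk' hδψ h'

/-! ## §2 The decision -/

/-- THEOREM D-fma-M♯, the positive half: under the grid conditions, `n ≥ m + 2` and
`M_φ = (2^m + J)·2^(k+1)`, `J ≤ 2^m`, a failing `fmaBinadeSlipTest m n J` gives `DFma φ ψ` (the
slip frame `binade_slip_sig` on positive sums, symmetry and the exact zero / zero-product cases).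
[this packet] -/
theorem dFma_of_fmaBinadeSlipTest_eq_false {φ ψ : Format} (hE : embedsTest φ ψ = true)
    (hm : 2 * φ.manBits + 1 ≤ ψ.manBits) (hbias : φ.bias ≤ ψ.bias) (hq2 : ψ.qexp ≤ 2 * φ.qexp)
    (hnorm : ψ.qexp + ψ.manBits + 1 ≤ φ.qexp) (h1 : 1 ≤ φ.manBits) (hb : 1 ≤ φ.bias)
    {n k J : ℕ} (hn : ψ.manBits = φ.manBits + n) (hn2 : φ.manBits + 2 ≤ n)
    (hk : k + (φ.manBits + φ.bias) = n + 1) (hJ : J ≤ 2 ^ φ.manBits)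
    (hM : φ.maxScaled = (2 ^ φ.manBits + J) * 2 ^ (k + 1))
    (hT : fmaBinadeSlipTest φ.manBits n J = false) : DFma φ ψ := by
  have key : ∀ {a b c : MiniFloat φ}, a.scaledMag ≠ 0 → b.scaledMag ≠ 0 →
      0 < a.toRat * b.toRat + c.toRat →
      (roundNE φ (roundNE ψ (a.toRat * b.toRat + c.toRat)).toRat).toRat
        = (roundNE φ (a.toRat * b.toRat + c.toRat)).toRat := by
    intro a b c ha hb0 hx
    by_contra h
    have hT' := binade_slip_sig hE hm hbias hq2 hnorm h1 hb hn hn2 hk hJ hM ha hb0 hx h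
    rw [hT] at hT'
    exact Bool.false_ne_true hT'
  intro a b c
  by_cases hab : a.scaledMag = 0 ∨ b.scaledMag = 0
  · have h0 : a.toRat * b.toRat = 0 := by
      rcases hab with h0 | h0 <;>
        simp [toRat_eq_toInt_mul a, toRat_eq_toInt_mul b, MiniFloat.toInt, h0]
    rw [h0, zero_add]
    exact toRat_roundNE_roundNE_of_exists (embeds_of_test hE c)
  simp only [not_or] at hab
  rcases lt_trichotomy (a.toRat * b.toRat + c.toRat) 0 with hneg | h0 | hpos
  · have h := key (a := a.flipSign) (b := b) (c := c.flipSign) hab.1 hab.2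
      (by simp only [toRat_flipSign]; linarith)
    simp only [toRat_flipSign] at h
    have e : -a.toRat * b.toRat + -c.toRat = -(a.toRat * b.toRat + c.toRat) := by ring
    rwa [e, toRat_roundNE_neg, toRat_roundNE_neg, toRat_roundNE_neg, neg_inj] at h
  · simp only [h0, toRat_roundNE_zero]
  · exact key hab.1 hab.2 hpos

/-- THEOREM D-fma-M♯ — THE FIRST BINADE ABOVE `W` DECIDED EXACTLY.  Grids nested (`embedsTest`),
`2 P_φ ≤ P_ψ`, `bias φ ≤ bias ψ`, `L_ψ ≤ 2 L_φ`, `L_ψ + P_ψ ≤ L_φ`, `m ≥ 1`, `bias φ ≥ 1`,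
`m_ψ = m + n` with `n ≥ m + 2`, `k + m + bias φ = n + 1`, and a source maximum
`M_φ = (2^m + J)·2^(k+1)` quanta, `J ≤ 2^m` (anywhere in `[W, 2W]`):
`DFma φ ψ ↔ fmaBinadeSlipTest m n J = false`.  The test is monotone in `J`; its least passing
`J` is `1` iff `fmaMidPairTest m n` (`fmaBinadeSlip_one_table`), `2` at `(m, n) = (12, 23)`
(`fmaBinadeSlip_12_23_one/two`). [this packet] -/
theorem dFma_binade_iff {φ ψ : Format} (hE : embedsTest φ ψ = true)
    (hm : 2 * φ.manBits + 1 ≤ ψ.manBits) (hbias : φ.bias ≤ ψ.bias) (hq2 : ψ.qexp ≤ 2 * φ.qexp)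
    (hnorm : ψ.qexp + ψ.manBits + 1 ≤ φ.qexp) (h1 : 1 ≤ φ.manBits) (hb : 1 ≤ φ.bias)
    {n k J : ℕ} (hn : ψ.manBits = φ.manBits + n) (hn2 : φ.manBits + 2 ≤ n)
    (hk : k + (φ.manBits + φ.bias) = n + 1) (hJ : J ≤ 2 ^ φ.manBits)
    (hM : φ.maxScaled = (2 ^ φ.manBits + J) * 2 ^ (k + 1)) :
    DFma φ ψ ↔ fmaBinadeSlipTest φ.manBits n J = false := by
  constructor
  · intro hD
    by_contra hT
    exact not_dFma_of_fmaBinadeSlipTest hE hm hq2 h1 hb hn hk hJ hM (by simpa using hT) hD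
  · exact dFma_of_fmaBinadeSlipTest_eq_false hE hm hbias hq2 hnorm h1 hb hn hn2 hk hJ hM

/-- MONOTONICITY IN THE SOURCE RANGE: a slip below `W + 2J·h` is a slip below `W + 2J'·h`,
`J ≤ J'`. [this packet] -/
theorem fmaBinadeSlipTest_mono {m n J J' : ℕ} (hJJ : J ≤ J')
    (h : fmaBinadeSlipTest m n J = true) : fmaBinadeSlipTest m n J' = true := by
  unfold fmaBinadeSlipTest at h ⊢
  obtain ⟨j, hjm, h⟩ := List.any_eq_true.mp h
  rw [List.mem_range] at hjm
  obtain ⟨i, him, hc⟩ := List.any_eq_true.mp h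
  refine List.any_eq_true.mpr ⟨j, List.mem_range.mpr (by omega), List.any_eq_true.mpr
    ⟨i, him, ?_⟩⟩
  simp only [fmaBinadeCond, Bool.and_eq_true, Bool.or_eq_true, decide_eq_true_eq] at hc ⊢
  obtain ⟨⟨⟨hw1, hw2⟩, hw3⟩, hsig⟩ := hc
  have : (J : ℤ) ≤ J' := by exact_mod_cast hJJ
  exact ⟨⟨⟨hw1, by linarith⟩, hw3⟩, hsig⟩

/-! ## §3 The kernel instances -/

/-- `J = 1` IS THEOREM D-fma-M's SIDE CONDITION: on every middle column `m + 2 ≤ n ≤ 2m`,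
`1 ≤ m ≤ 11`, `fmaBinadeSlipTest m n 1 = fmaMidPairTest m n` (both `true` there,
`fmaMidPair_table`; implementation A: `J⋆ = 1` on every middle column with `m ≤ 16` except
`(12, 23)` and `(16, 31)`). [this packet] -/
theorem fmaBinadeSlip_one_table :
    ∀ m < 12, ∀ n < 2 * m + 1, 1 ≤ m → m + 2 ≤ n →
      fmaBinadeSlipTest m n 1 = fmaMidPairTest m n := by
  decide +kernel

/-- WIDE REGISTERS HAVE NO SLIP IN THE BINADE: `n ≥ 2m + 2` ⟹ the test fails for every
`J ≤ 2^m` (`|e| ≤ 1` leaves `|e·2^n ± 1| ∈ {1, 2^n ± 1}`: `1 = 1·1` needs `w = 2t + 1` odd above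
`2^(m+1)`, and `2^n ± 1 ≥ 2^(2m+2) - 1` exceeds every product of two `P_φ`-digit significands) —
the kernel instance `m ≤ 6` of THEOREM D-fma-W's positive half. [this packet] -/
theorem fmaBinadeSlip_wide_table :
    ∀ m < 7, ∀ n < 2 * m + 4, 1 ≤ m → 2 * m + 2 ≤ n → ∀ J < 2 ^ m + 1,
      fmaBinadeSlipTest m n J = false := by
  decide +kernel

/-- THE FIRST EXCEPTION, lower half: a `13`-digit source through a `36`-digit register with
largest value `W + 2h` (`J = 1`) has NO slip — `DFma` holds one step above `W`
(`fmaMidPair_12_23`: `2^23 - 1 = 47·178481`, no `K·2^23 + 1`, `K < 8`, splits). [this packet] -/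
theorem fmaBinadeSlip_12_23_one : fmaBinadeSlipTest 12 23 1 = false := by
  decide +kernel

/-- THE FIRST EXCEPTION, upper half: with largest value `W + 4h` (`J = 2`) the FMA slips —
`6563·7669 = 6·2^23 - 1`: `a = 6563`, `b = 7669`, `c = (2^13 - 3)·2^k` quanta sum to one
`quantum φ²` below the midpoint `W + 3h` (`t = 2^12 + 1` odd).  So at `(m, n) = (12, 23)` the
exact threshold of `DFma` is `M_φ = W + 2h`, not `W`. [this packet] -/
theorem fmaBinadeSlip_12_23_two : fmaBinadeSlipTest 12 23 2 = true := by
  decide +kernel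

end Summit.Ventures.CertifiedArithmetic
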